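import Literature.MathematicalPhysics.QuantumFieldTheory.Balaban1983to89.Node00.BoxStaircasePhase

/-!
# NODE 00 — FILE 3a′: EXACTNESS OF THE STAIRCASE PHASE FROM PLAQUETTE-LOCAL FLATNESS — the coordinate-staircase integral `Θ = stairSum φ` of a bond phase `φ`
# is a potential (`Θ(x + e_ν) − Θ(x) = φ(x, ν)`) on the whole box as soon as `φ` is EXACT ON EVERY PLAQUETTE of the box; and the determinant phase of a
# site function is plaquette-exact under the PER-BOND window `4τ < 2π` — NO total-width condition `(2W + 1)·τ < 2π`

Cell `pub-ymgap`, width seat `pub-ymgap-dag-n07-w3` generation 7 (sub-target S3 = [15] (145)–(156) at objects; CLAIM-4 ∕ INTENT-4, cell INBOX 2026-08-28;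
located items LOCATED-LANDAU-REGION (dag-n07-w8 g6) and LOCATED-SU-NORMALISATION-BELOW-TOP (this seat)).  NEW leaf on dag-n07-e's FILE 3a
`Node00.BoxStaircasePhase` (p5373xx lineage: the public `stairPt ∕ cornerPt ∕ segSum ∕ stairSum`, `lam_eq_mul_exp_stairSum`); nothing modified.
`--kind proof --supports stmt-QuantumFields-27364` (K1⁹; count-neutral helper).  [6] = [Balaban1985RegularSpaces]; [3] = [Balaban1985Averaging]; [15] = [Balaban1985Variational].

WHY.  FILE 3b's `U(N) → SU(N)` normalisation of [6] Prop. 6's unitary gauge (`Node00.TorusCoverSUGauge.exists_suGauge_of_unitaryGauge`) integrates the determinant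
phase along the coordinate staircase and needs EXACTNESS of that integral on every bond of the box; FILE 3a proves exactness from the TOTAL-WIDTH window
`(2W + 1)·τ < 2π` (the loop «staircase to `x`, the bond, staircase back from `x + e_ν`» has phase a multiple of `2π` of modulus `< 2π`).  That window is met on
the TOP box of a datum (`|A| ≤ r`, per-bond phase `ηN r = N r L^{−k}`, width `≈ Lᵏ·sideP`) but FAILS on the lower cubes `□_j`, `j < k`, of the (1.131) tower,
where [6] (1.136) ∕ [15] (152) bound the potential only with the weight `(Lʲη)⁻¹` («`Lʲη|A| < 9dL²B₁Mε₀` on `Ω′_j`») — the per-bond phase stays `≤ N r`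
but the width grows like `Lᵏ`: LOCATED-SU-NORMALISATION-BELOW-TOP.  THIS FILE removes the width from the argument: the determinant phase of a SITE function
`λ` is automatically FLAT on every plaquette (the product of the four ratios is `1`), hence — if each bond angle is `≤ τ` with `4τ < 2π` — EXACT on every
plaquette (§2); and a plaquette-exact bond function has the staircase sum as a potential on the whole box by a discrete Stokes bookkeeping with NO size
condition (§3: the staircases to `x` and to `x + e_ν` share the segments `μ < ν`, differ by one step on segment `ν`, and run parallel at distance `e_ν`
on the segments `μ > ν`, where the plaquette relation telescopes each segment difference to `φ(corner_{μ+1}, ν) − φ(corner_μ, ν)`).  FILE 3b′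
(`Node00.TorusCoverSUGaugeLocal`) then normalises [6]'s gauge on ANY box under the per-bond window `4ηN·sup‖A‖ < 2π` — on the whole tower `□₀` of a datum,
height-uniformly — which is what the S3 lane owes for the (152) letters «on `Ω′_j`» (print) rather than on the top box only (tree).

WHAT IS PROVED (kernel; `d` arbitrary; elementary; no definition).
* §1 private staircase helpers (copies of FILE 3a's private bookkeeping: corners, segment steps, box membership) and the three comparisons of the staircases
  to `x` and to `x + e_ν` (segments `μ < ν` equal, segment `ν` one step longer, segments `μ > ν` translated by `e_ν`).
* §2 `plaquette_exact_of_step_of_small` (a site function's bond phase with `|φ| ≤ τ`, `4τ < 2π` is exact on every plaquette of the box).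
* §3 ★★ `stairSum_add_e_sub_eq_of_plaquette` (plaquette-exact ⇒ `stairSum φ (x + e_ν) − stairSum φ x = φ x ν` on every bond of the box — NO width window) and
  ★★ `stairSum_add_e_sub_eq_local` (the same from `λ(y + e_μ) = λ(y)e^{iφ(y,μ)}`, `λ ≠ 0` on the box, `|φ| ≤ τ`, `4τ < 2π`).
HONEST FRAMING: elementary lattice ∕ complex bookkeeping; nothing of Bałaban asserted or discharged; no token ∕ stub ∕ K-item closed; N07 ∕ N05 NOT discharged;
counts unmoved; one finite 𝕋⁴ programme at fixed ε — R4 closes the conditional finite-𝕋⁴ rung `BalabanLadder.UV` only; the YM mass gap (Clay) is NOT proved by any of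
this; nothing continuum ∕ ℝ⁴ ∕ OS.  No `sorry`, no `def`, no `instance`, no `notation`.

References: [Balaban1985Averaging] (9) p.18 (parallel transport along contours); [Balaban1985RegularSpaces] Prop. 6 p.99, (1.136) p.99, (1.131) p.99;
[Balaban1985Variational] (152) p.301.
-/

noncomputable section

namespace Literature.MathematicalPhysics.QuantumFieldTheory.Balaban1983to89.Node00

open Complex (I)
open B7Prop1Explicit (e e_apply)
open B7Prop1Local (InBox)

variable {d : ℕ}

/-! ## §1  Staircase bookkeeping: corners, steps, and the staircases to `x` and to `x + e_ν` -/

section Helpers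

/-- All segments walked: the staircase ends at `x`. [folklore] -/
private theorem cornerPt_of_le' (lo x : B7Prop1Explicit.Site d) {m : ℕ} (hm : d ≤ m) : cornerPt lo x m = x := by
  funext κ; simp [cornerPt, lt_of_lt_of_le κ.isLt hm]

/-- The `μ`-th segment starts at the `μ`-th corner. [folklore] -/
private theorem stairPt_lo' (lo x : B7Prop1Explicit.Site d) (μ : Fin d) : stairPt lo x μ.val (lo μ) = cornerPt lo x μ.val := by
  funext κ
  by_cases h1 : κ.val < μ.val
  · simp [stairPt, cornerPt, h1]
  · by_cases h2 : κ.val = μ.val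
    · have : κ = μ := Fin.ext h2
      subst this
      simp [stairPt, cornerPt]
    · simp [stairPt, cornerPt, h1, h2]

/-- The `μ`-th segment ends at the `(μ+1)`-th corner. [folklore] -/
private theorem stairPt_self' (lo x : B7Prop1Explicit.Site d) (μ : Fin d) : stairPt lo x μ.val (x μ) = cornerPt lo x (μ.val + 1) := by
  funext κ
  by_cases h1 : κ.val < μ.val
  · simp [stairPt, cornerPt, h1, Nat.lt_succ_of_lt h1]
  · by_cases h2 : κ.val = μ.val
    · have : κ = μ := Fin.ext h2
      subst this
      simp [stairPt, cornerPt]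
    · have h3 : ¬κ.val < μ.val + 1 := by omega
      simp [stairPt, cornerPt, h1, h2, h3]

/-- One step along the `μ`-th segment is the unit step `e_μ`. [folklore] -/
private theorem stairPt_succ' (lo x : B7Prop1Explicit.Site d) (μ : Fin d) (t : ℤ) : stairPt lo x μ.val (t + 1) = stairPt lo x μ.val t + e μ := by
  funext κ
  rw [Pi.add_apply, e_apply]
  by_cases h1 : κ.val < μ.val
  · have : κ ≠ μ := fun h => by subst h; exact lt_irrefl _ h1
    simp [stairPt, h1, this]
  · by_cases h2 : κ.val = μ.val
    · have : κ = μ := Fin.ext h2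
      subst this
      simp [stairPt]
    · have : κ ≠ μ := fun h => h2 (by rw [h])
      simp [stairPt, h1, h2, this]

/-- The points of the `μ`-th segment with parameter in `[lo_μ, hi_μ]` lie in the box (when `x` does). [folklore] -/
private theorem inBox_stairPt' {lo hi x : B7Prop1Explicit.Site d} (hx : InBox lo hi x) (μ : Fin d) {t : ℤ} (ht : lo μ ≤ t) (ht' : t ≤ hi μ) :
    InBox lo hi (stairPt lo x μ.val t) := by
  intro κ
  by_cases h1 : κ.val < μ.val
  · simp only [stairPt, h1, ↓reduceIte]; exact hx κ
  · by_cases h2 : κ.val = μ.val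
    · have : κ = μ := Fin.ext h2
      subst this
      simp only [stairPt, lt_irrefl, ↓reduceIte]; exact ⟨ht, ht'⟩
    · simp only [stairPt, h1, h2, ↓reduceIte]; exact ⟨le_rfl, (hx κ).1.trans (hx κ).2⟩

/-- Segments BEFORE `ν`: the staircase to `x + e_ν` coincides with the staircase to `x`. [folklore] -/
private theorem stairPt_add_e_of_lt (lo x : B7Prop1Explicit.Site d) {μ ν : Fin d} (h : μ.val < ν.val) (t : ℤ) :
    stairPt lo (x + e ν) μ.val t = stairPt lo x μ.val t := by
  funext κ
  by_cases h1 : κ.val < μ.val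
  · have hκν : κ ≠ ν := fun hh => by subst hh; omega
    simp [stairPt, h1, e_apply, hκν]
  · by_cases h2 : κ.val = μ.val
    · simp [stairPt, h2]
    · simp [stairPt, h1, h2]

/-- Segment `ν` itself: the same points (the staircase to `x + e_ν` only walks one step further). [folklore] -/
private theorem stairPt_add_e_self (lo x : B7Prop1Explicit.Site d) (ν : Fin d) (t : ℤ) :
    stairPt lo (x + e ν) ν.val t = stairPt lo x ν.val t := by
  funext κ
  by_cases h1 : κ.val < ν.val
  · have hκν : κ ≠ ν := fun hh => by subst hh; omega
    simp [stairPt, h1, e_apply, hκν]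
  · by_cases h2 : κ.val = ν.val
    · simp [stairPt, h2]
    · simp [stairPt, h1, h2]

/-- Segments AFTER `ν`: the staircase to `x + e_ν` is the staircase to `x` translated by `e_ν`. [folklore] -/
private theorem stairPt_add_e_of_gt (lo x : B7Prop1Explicit.Site d) {μ ν : Fin d} (h : ν.val < μ.val) (t : ℤ) :
    stairPt lo (x + e ν) μ.val t = stairPt lo x μ.val t + e ν := by
  funext κ
  rw [Pi.add_apply, e_apply]
  by_cases h1 : κ.val < μ.val
  · by_cases hκν : κ = ν
    · subst hκν; simp [stairPt, h1, e_apply]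
    · simp [stairPt, h1, e_apply, hκν]
  · have hκν : κ ≠ ν := fun hh => by subst hh; omega
    by_cases h2 : κ.val = μ.val
    · simp [stairPt, h2, hκν]
    · simp [stairPt, h1, h2, hκν]

end Helpers

/-! ## §2  The determinant phase of a site function is exact on every plaquette under the per-bond window -/

section Plaquette

variable {lo hi : B7Prop1Explicit.Site d} {lam : B7Prop1Explicit.Site d → ℂ} {φ : B7Prop1Explicit.Site d → Fin d → ℝ}

/-- A real number `δ` with `e^{iδ} = 1` and `|δ| < 2π` vanishes. [folklore] -/
private theorem eq_zero_of_exp_I_mul_eq_one' {δ : ℝ} (h : Complex.exp (I * δ) = 1) (hδ : |δ| < 2 * Real.pi) : δ = 0 := by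
  obtain ⟨n, hn⟩ := Complex.exp_eq_one_iff.1 h
  have hnorm : |δ| = |(n : ℝ)| * (2 * Real.pi) := by
    have h1 : ‖(I * δ : ℂ)‖ = ‖(n : ℂ) * (2 * Real.pi * I)‖ := by rw [hn]
    rw [norm_mul, Complex.norm_I, one_mul, Complex.norm_real, Real.norm_eq_abs] at h1
    rw [h1, norm_mul, Complex.norm_intCast]
    have : ‖(2 * Real.pi * I : ℂ)‖ = 2 * Real.pi := by
      rw [norm_mul, Complex.norm_I, mul_one]
      simp [abs_of_pos Real.pi_pos]
    rw [this]
  have hn0 : n = 0 := by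
    have h2 : |(n : ℝ)| * (2 * Real.pi) < 1 * (2 * Real.pi) := by rw [← hnorm, one_mul]; exact hδ
    have h3 : |(n : ℝ)| < 1 := lt_of_mul_lt_mul_right h2 (by positivity)
    have : |n| < 1 := by exact_mod_cast h3
    exact Int.abs_lt_one_iff.1 this
  subst hn0
  have h4 : (I * δ : ℂ) = 0 := by rw [hn]; simp
  have h5 : (δ : ℂ) = 0 := by
    rcases mul_eq_zero.1 h4 with h6 | h6
    · exact absurd h6 Complex.I_ne_zero
    · exact h6
  exact_mod_cast h5

/-- **THE DETERMINANT PHASE IS EXACT ON EVERY PLAQUETTE UNDER THE PER-BOND WINDOW**: if `λ(y + e_μ) = λ(y)·e^{iφ(y,μ)}` on the box's bonds, `λ ≠ 0` on the box,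
`|φ| ≤ τ` on the box's bonds and `4τ < 2π`, then for every plaquette `(x; μ, ν)` with its four corners in the box
`φ(x, μ) + φ(x + e_μ, ν) = φ(x, ν) + φ(x + e_ν, μ)` (the two ways round to `x + e_μ + e_ν` give `e^{i(…)} = 1` with modulus of the exponent `≤ 4τ < 2π`).
[cite: Balaban1985Averaging, (9) p.18 (parallel transport along a contour; bookkeeping); Balaban1985RegularSpaces, Prop. 6 p.99] -/
theorem plaquette_exact_of_step_of_small
    (hstep : ∀ y μ, InBox lo hi y → InBox lo hi (y + e μ) → lam (y + e μ) = lam y * Complex.exp (I * φ y μ))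
    (hlam : ∀ y, InBox lo hi y → lam y ≠ 0) {τ : ℝ} (hτ : ∀ y μ, InBox lo hi y → InBox lo hi (y + e μ) → |φ y μ| ≤ τ)
    (h4 : 4 * τ < 2 * Real.pi) {x : B7Prop1Explicit.Site d} {μ ν : Fin d}
    (hx : InBox lo hi x) (hxμ : InBox lo hi (x + e μ)) (hxν : InBox lo hi (x + e ν)) (hxμν : InBox lo hi (x + e μ + e ν)) :
    φ x μ + φ (x + e μ) ν = φ x ν + φ (x + e ν) μ := by
  have hcomm : x + e μ + e ν = x + e ν + e μ := add_right_comm _ _ _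
  have hxνμ : InBox lo hi (x + e ν + e μ) := hcomm ▸ hxμν
  have h1 : lam (x + e μ + e ν) = lam x * Complex.exp (I * φ x μ) * Complex.exp (I * φ (x + e μ) ν) := by
    rw [hstep _ ν hxμ hxμν, hstep _ μ hx hxμ]
  have h2 : lam (x + e μ + e ν) = lam x * Complex.exp (I * φ x ν) * Complex.exp (I * φ (x + e ν) μ) := by
    rw [hcomm, hstep _ μ hxν hxνμ, hstep _ ν hx hxν]
  have h3 : Complex.exp (I * φ x μ) * Complex.exp (I * φ (x + e μ) ν) = Complex.exp (I * φ x ν) * Complex.exp (I * φ (x + e ν) μ) := by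
    have h := h1.symm.trans h2
    rw [mul_assoc, mul_assoc] at h
    exact mul_left_cancel₀ (hlam x hx) h
  have h5 : Complex.exp (I * ↑(φ x μ + φ (x + e μ) ν - (φ x ν + φ (x + e ν) μ))) = 1 := by
    have hne : Complex.exp (I * φ x ν) * Complex.exp (I * φ (x + e ν) μ) ≠ 0 := mul_ne_zero (Complex.exp_ne_zero _) (Complex.exp_ne_zero _)
    have h6 : Complex.exp (I * ↑(φ x μ + φ (x + e μ) ν - (φ x ν + φ (x + e ν) μ))) * (Complex.exp (I * φ x ν) * Complex.exp (I * φ (x + e ν) μ)) =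
        Complex.exp (I * φ x μ) * Complex.exp (I * φ (x + e μ) ν) := by
      rw [← Complex.exp_add, ← Complex.exp_add, ← Complex.exp_add]
      push_cast
      ring_nf
    rw [h3] at h6
    exact (mul_eq_right₀ hne).1 h6
  refine sub_eq_zero.1 (eq_zero_of_exp_I_mul_eq_one' h5 ?_)
  have ha := hτ x μ hx hxμ
  have hb := hτ (x + e μ) ν hxμ hxμν
  have hc := hτ x ν hx hxν
  have hd := hτ (x + e ν) μ hxν hxνμ
  have : |φ x μ + φ (x + e μ) ν - (φ x ν + φ (x + e ν) μ)| ≤ |φ x μ| + |φ (x + e μ) ν| + (|φ x ν| + |φ (x + e ν) μ|) :=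
    (abs_sub _ _).trans (add_le_add (abs_add_le _ _) (abs_add_le _ _))
  linarith

end Plaquette

/-! ## §3  ★★ Exactness of the staircase sum from plaquette exactness — no width window -/

section Stokes

variable {lo hi x : B7Prop1Explicit.Site d} {φ : B7Prop1Explicit.Site d → Fin d → ℝ}

/-- Segments before `ν` contribute equally to the two staircase sums. [folklore] -/
private theorem segSum_add_e_of_lt (lo x : B7Prop1Explicit.Site d) (φ : B7Prop1Explicit.Site d → Fin d → ℝ) {μ ν : Fin d} (h : μ.val < ν.val) :
    segSum lo φ (x + e ν) μ = segSum lo φ x μ := by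
  have hμν : μ ≠ ν := fun hh => by subst hh; exact lt_irrefl _ h
  unfold segSum
  rw [show (x + e ν) μ - lo μ = x μ - lo μ by rw [Pi.add_apply, e_apply, if_neg hμν, add_zero]]
  exact Finset.sum_congr rfl fun i _ => by rw [stairPt_add_e_of_lt lo x h]

/-- Segment `ν` of the staircase to `x + e_ν` is segment `ν` of the staircase to `x` plus ONE more bond, at the corner `corner_{ν+1}(x)`. [folklore] -/
private theorem segSum_add_e_self (hx : InBox lo hi x) (φ : B7Prop1Explicit.Site d → Fin d → ℝ) (ν : Fin d) :
    segSum lo φ (x + e ν) ν = segSum lo φ x ν + φ (cornerPt lo x (ν.val + 1)) ν := by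
  have h0 : (0 : ℤ) ≤ x ν - lo ν := by have := hx ν; omega
  unfold segSum
  have hlen : ((x + e ν) ν - lo ν).toNat = (x ν - lo ν).toNat + 1 := by
    rw [Pi.add_apply, e_apply, if_pos rfl]
    have : x ν + 1 - lo ν = (x ν - lo ν) + 1 := by ring
    rw [this]
    omega
  rw [hlen, Finset.sum_range_succ]
  congr 1
  · exact Finset.sum_congr rfl fun i _ => by rw [stairPt_add_e_self lo x ν]
  · rw [stairPt_add_e_self lo x ν, show lo ν + ((x ν - lo ν).toNat : ℤ) = x ν by rw [Int.toNat_of_nonneg h0]; ring, stairPt_self']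

/-- Segments after `ν`: under plaquette exactness, the translated segment sum differs from the original by the telescoped `φ(corner_{μ+1}, ν) − φ(corner_μ, ν)`.
[cite: Balaban1985Averaging, (9) p.18 (bookkeeping)] -/
private theorem segSum_add_e_of_gt (hx : InBox lo hi x) {ν : Fin d} (hx' : InBox lo hi (x + e ν))
    (hplaq : ∀ (y : B7Prop1Explicit.Site d) (μ κ : Fin d), InBox lo hi y → InBox lo hi (y + e μ) → InBox lo hi (y + e κ) → InBox lo hi (y + e μ + e κ) →
      φ y μ + φ (y + e μ) κ = φ y κ + φ (y + e κ) μ)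
    {μ : Fin d} (h : ν.val < μ.val) :
    segSum lo φ (x + e ν) μ = segSum lo φ x μ + (φ (cornerPt lo x (μ.val + 1)) ν - φ (cornerPt lo x μ.val) ν) := by
  have hμν : μ ≠ ν := fun hh => by subst hh; exact lt_irrefl _ h
  have h0 : (0 : ℤ) ≤ x μ - lo μ := by have := hx μ; omega
  have hlen : (x + e ν) μ - lo μ = x μ - lo μ := by rw [Pi.add_apply, e_apply, if_neg hμν, add_zero]
  -- the plaquette relation along segment `μ`: `φ(p + e_ν, μ) = φ(p, μ) + (φ(p + e_μ, ν) − φ(p, ν))`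
  have hterm : ∀ i ∈ Finset.range (x μ - lo μ).toNat,
      φ (stairPt lo (x + e ν) μ.val (lo μ + i)) μ =
        φ (stairPt lo x μ.val (lo μ + i)) μ +
          (φ (stairPt lo x μ.val (lo μ + ((i + 1 : ℕ) : ℤ))) ν - φ (stairPt lo x μ.val (lo μ + i)) ν) := by
    intro i him
    have hxμ := hx μ
    have hi' : (i : ℤ) < x μ - lo μ := by
      have h1 := Finset.mem_range.1 him
      have h2 : ((x μ - lo μ).toNat : ℤ) = x μ - lo μ := Int.toNat_of_nonneg h0
      omega
    set p := stairPt lo x μ.val (lo μ + i) with hp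
    have hp1 : stairPt lo x μ.val (lo μ + ((i + 1 : ℕ) : ℤ)) = p + e μ := by rw [hp, ← stairPt_succ']; push_cast; ring_nf
    have hpν : stairPt lo (x + e ν) μ.val (lo μ + i) = p + e ν := by rw [hp, stairPt_add_e_of_gt lo x h]
    have hpin : InBox lo hi p := inBox_stairPt' hx μ (by omega) (by omega)
    have hpμ : InBox lo hi (p + e μ) := by rw [← hp1]; exact inBox_stairPt' hx μ (by push_cast; omega) (by push_cast; omega)
    have hpνin : InBox lo hi (p + e ν) := by rw [← hpν]; exact inBox_stairPt' hx' μ (by omega) (by omega)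
    have hpμν : InBox lo hi (p + e μ + e ν) := by
      have : p + e μ + e ν = stairPt lo (x + e ν) μ.val (lo μ + ((i + 1 : ℕ) : ℤ)) := by
        rw [stairPt_add_e_of_gt lo x h, hp1]
      rw [this]; exact inBox_stairPt' hx' μ (by push_cast; omega) (by push_cast; omega)
    rw [hpν, hp1]
    have := hplaq p μ ν hpin hpμ hpνin hpμν
    linarith
  unfold segSum
  rw [hlen, Finset.sum_congr rfl hterm, Finset.sum_add_distrib,
    Finset.sum_range_sub (fun i => φ (stairPt lo x μ.val (lo μ + (i : ℤ))) ν) (x μ - lo μ).toNat]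
  simp only [Nat.cast_zero, add_zero, stairPt_lo']
  rw [show lo μ + ((x μ - lo μ).toNat : ℤ) = x μ by rw [Int.toNat_of_nonneg h0]; ring, stairPt_self']

/-- ★★ **EXACTNESS OF THE STAIRCASE SUM FROM PLAQUETTE EXACTNESS — NO WIDTH WINDOW**: if the bond function `φ` is exact on every plaquette of the box
(`φ(y, μ) + φ(y + e_μ, κ) = φ(y, κ) + φ(y + e_κ, μ)` whenever the four corners lie in the box), then its coordinate-staircase integral is a potential for
it on the whole box: `stairSum φ (x + e_ν) − stairSum φ x = φ(x, ν)` for every bond `⟨x, x + e_ν⟩` of the box.  Discrete Stokes: segments `μ < ν` agree,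
segment `ν` is one bond longer (at `corner_{ν+1}`), segments `μ > ν` run parallel at distance `e_ν` and their differences telescope to
`φ(corner_{μ+1}, ν) − φ(corner_μ, ν)`, which telescope in `μ` to `φ(x, ν) − φ(corner_{ν+1}, ν)`.
[cite: Balaban1985Averaging, (9) p.18 (parallel transport along contours; bookkeeping); Balaban1985RegularSpaces, Prop. 6 p.99 («there exists a gauge transformation u»)] -/
theorem stairSum_add_e_sub_eq_of_plaquette (hx : InBox lo hi x) {ν : Fin d} (hx' : InBox lo hi (x + e ν))
    (hplaq : ∀ (y : B7Prop1Explicit.Site d) (μ κ : Fin d), InBox lo hi y → InBox lo hi (y + e μ) → InBox lo hi (y + e κ) → InBox lo hi (y + e μ + e κ) →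
      φ y μ + φ (y + e μ) κ = φ y κ + φ (y + e κ) μ) :
    stairSum lo φ (x + e ν) - stairSum lo φ x = φ x ν := by
  -- per-segment differences
  set g : ℕ → ℝ := fun m => φ (cornerPt lo x m) ν with hg
  have hdiff : ∀ μ : Fin d, segSum lo φ (x + e ν) μ - segSum lo φ x μ =
      (if μ.val < ν.val then 0 else if μ.val = ν.val then g (ν.val + 1) else g (μ.val + 1) - g μ.val) := by
    intro μ
    by_cases h1 : μ.val < ν.val
    · rw [if_pos h1, segSum_add_e_of_lt lo x φ h1, sub_self]
    · rw [if_neg h1]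
      by_cases h2 : μ.val = ν.val
      · have : μ = ν := Fin.ext h2
        subst this
        rw [if_pos rfl, segSum_add_e_self hx φ μ, hg]; ring
      · rw [if_neg h2, segSum_add_e_of_gt hx hx' hplaq (by omega), hg]; ring
  have hsum : stairSum lo φ (x + e ν) - stairSum lo φ x = ∑ μ : Fin d, (segSum lo φ (x + e ν) μ - segSum lo φ x μ) := by
    unfold stairSum; rw [Finset.sum_sub_distrib]
  rw [hsum, Finset.sum_congr rfl fun μ _ => hdiff μ]
  -- pass to a `Finset.range d` sum and split at `ν + 1`
  rw [Fin.sum_univ_eq_sum_range (fun m => if m < ν.val then (0 : ℝ) else if m = ν.val then g (ν.val + 1) else g (m + 1) - g m) d]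
  have hνd : ν.val + 1 ≤ d := ν.isLt
  rw [← Finset.sum_range_add_sum_Ico _ hνd, Finset.sum_range_succ]
  have hlow : ∑ m ∈ Finset.range ν.val, (if m < ν.val then (0 : ℝ) else if m = ν.val then g (ν.val + 1) else g (m + 1) - g m) = 0 :=
    Finset.sum_eq_zero fun m hm => by rw [if_pos (Finset.mem_range.1 hm)]
  have hmid : (if ν.val < ν.val then (0 : ℝ) else if ν.val = ν.val then g (ν.val + 1) else g (ν.val + 1) - g ν.val) = g (ν.val + 1) := by
    rw [if_neg (lt_irrefl _), if_pos rfl]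
  have hhigh : ∑ m ∈ Finset.Ico (ν.val + 1) d, (if m < ν.val then (0 : ℝ) else if m = ν.val then g (ν.val + 1) else g (m + 1) - g m) = g d - g (ν.val + 1) := by
    rw [Finset.sum_Ico_eq_sum_range]
    have : ∀ k ∈ Finset.range (d - (ν.val + 1)),
        (if ν.val + 1 + k < ν.val then (0 : ℝ) else if ν.val + 1 + k = ν.val then g (ν.val + 1) else g (ν.val + 1 + k + 1) - g (ν.val + 1 + k)) =
          g (ν.val + 1 + (k + 1)) - g (ν.val + 1 + k) := by
      intro k _
      rw [if_neg (by omega), if_neg (by omega), show ν.val + 1 + k + 1 = ν.val + 1 + (k + 1) by omega]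
    rw [Finset.sum_congr rfl this, Finset.sum_range_sub (fun k => g (ν.val + 1 + k)) (d - (ν.val + 1))]
    rw [show ν.val + 1 + (d - (ν.val + 1)) = d by omega, add_zero]
  rw [hlow, hmid, hhigh, zero_add, hg]
  simp only
  rw [cornerPt_of_le' lo x le_rfl]
  ring

/-- ★★ **EXACTNESS OF THE STAIRCASE PHASE UNDER THE PER-BOND WINDOW** — FILE 3a's `stairSum_add_e_sub_eq` with the total-width window `(2W + 1)·τ < 2π`
REPLACED by the per-bond window `4τ < 2π`: if `λ(y + e_μ) = λ(y)·e^{iφ(y,μ)}` on the box's bonds, `λ ≠ 0` on the box, `|φ| ≤ τ` there, then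
`stairSum φ (x + e_ν) − stairSum φ x = φ(x, ν)` on every bond of the box (§2 ∘ `stairSum_add_e_sub_eq_of_plaquette`).
[cite: Balaban1985Averaging, (9) p.18; Balaban1985RegularSpaces, Prop. 6 p.99, (1.136) p.99; Balaban1985Variational, (152) p.301] -/
theorem stairSum_add_e_sub_eq_local {lam : B7Prop1Explicit.Site d → ℂ} (hx : InBox lo hi x) {ν : Fin d} (hx' : InBox lo hi (x + e ν))
    (hstep : ∀ y μ, InBox lo hi y → InBox lo hi (y + e μ) → lam (y + e μ) = lam y * Complex.exp (I * φ y μ))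
    (hlam : ∀ y, InBox lo hi y → lam y ≠ 0) {τ : ℝ} (hτ : ∀ y μ, InBox lo hi y → InBox lo hi (y + e μ) → |φ y μ| ≤ τ)
    (h4 : 4 * τ < 2 * Real.pi) :
    stairSum lo φ (x + e ν) - stairSum lo φ x = φ x ν :=
  stairSum_add_e_sub_eq_of_plaquette hx hx' fun _ _ _ hy hyμ hyκ hyμκ => plaquette_exact_of_step_of_small hstep hlam hτ h4 hy hyμ hyκ hyμκ

end Stokes

end Literature.MathematicalPhysics.QuantumFieldTheory.Balaban1983to89.Node00

end
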